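/-
Copyright (c) 2026 the pub-hodgecm-mathlib formalisation cell (harness21).  Prover seat hodgecm-mathlib-R90-CS-p03 (g0) for R90-TF section S8 «ContSpec-n½» (planner R90-CS-plan (g0), deal
«TWIN row 7b» 16:29:29Z; census K2E1-p16 (g2) `CENSUS-ArchSymbolU3.md` 22c1f7b6455c1744): the `U(2,1)` twin of ★ `K2E1ArchSymbolCirclePhaseU2` (K2-defs1 (g6)).
-/
import Summits.HodgeConjecture.HodgeConjecture.Theorems.K2E1ArchSymbolCirclePhaseU2             -- ★ the `N = 2` original: §1 support control (rank-generic, reused by name), and its rank-generic imports ★ `K2E1ArchSymbolFormulaU2` (2c-A), ★ `K2E1ArchTestFunctionSymbolU2` (P1), ★ `K2E1SymbolPositivitySecondDifference`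
import Summits.HodgeConjecture.HodgeConjecture.Theorems.K2E1BLUniquenessU3                        -- ★ `one_mem_closure_setOf_one_lt_borelHeight_three` (the `N = 3` torus ray; no `c² = 1`)
import HarnessLib

/-!
# K2·E1 ∕ R90·S8 — `K2E1ArchSymbolCirclePhaseU3` (TWIN row 7b): THE ARCHIMEDEAN GAUGE SYMBOL ON `V(χ, K′, ω)` FOR `U(2,1)` — convData_χ's letters `hfam`∕`hnc` at `N = 3`

Cell `pub/hodgecm-mathlib`, crux h413 = `stmt-HodgeConjecture-24833`, route of record `HCCMUnconditional`; R90-TF section S8 «ContSpec-n½» (E-S8-def-cont ∕ the `U(Φ₃)` χ-twin programme,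
K2E1-p16's TWIN-DAG v1 row 7b).  THEOREMS ONLY (no `def`, no `instance`, no notation, no named-fact hypothesis, no `sorry`; `maxHeartbeats 400000` on the core exactly as the ★ original);
lane `--supports stmt-HodgeConjecture-24833 --as helper` (count-neutral).  Closes no socket.

THE MATHEMATICS AND THE TWIN ([Bump1997] proof of Lemma 2.3.2; [BernsteinLapid2019] §4 Claim 1–2; [Langlands1976] §6).  ★ `K2E1ArchSymbolCirclePhaseU2` pays the letters `hfam`∕`hnc` of the
χ-convolution data at `V := chiSectionSpace χ K′ ω` by archimedean GAUGE test functions `η_ψ = α_ψ ⊗ 𝟙_{U₀}`: the self-convolution `S_{η̃}η̃` acts on every `f_z^φ`, `φ ∈ V`, by an ENTIRE scalar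
`s(z)` (★ 12d-C scalar action + ★ P1), `s(z₀) ≠ 0` from the phase-control neighbourhood `{½ ≤ Re ΦR^{z₀}}` (★ `integral_ne_zero_of_re_ge_half`), and `s` is NON-CONSTANT from the
archimedean ray (★ `exists_apply_ne_apply_of_secondDiff`).  Every engine is rank-generic (`(quasiSplit F E c N)`); the ONLY `N = 2` pin of the original is §2's ray lemma over ★
`one_mem_closure_setOf_one_lt_borelHeight_two (c² = 1)`, whose `N = 3` counterpart ★ `K2E1BLUniquenessU3.one_mem_closure_setOf_one_lt_borelHeight_three` needs no `c² = 1` — so the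
`U(2,1)` core drops the binder `hc2`.  SCOPE (honest, census §0 (b)): `chiSectionSpace χ K′ ω` has a SCALAR `ω`, i.e. one-dimensional `K_∞`-types only; at `N = 3` the principal series of
`U(2,1)(ℝ)` also has higher-dimensional `K_∞ = U(2)×U(1)`-types, which this currency does not see (booked L∕XL, not on the sheet; not needed by S8B#2's road).
* §1 `exists_mem_borelHeight_archToAdelic_ne_one_three` — the archimedean ray at `N = 3`;
* §2 `exists_gauge_symbol_three` — THE CORE at `N = 3` (★ original's §3 with `2 ↦ 3`, `hc2` dropped);
* §3 HEADS `hfam_gauge_cm_three`, `hnc_gauge_cm_three` — bytes = ★ TWIN #1 `K2E1ChiConvDataCMThree.exists_chi_convData_cm_three`'s `hfam`∕`hnc` at `V := chiSectionSpace χ K′ ω`.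
HONEST LABEL: HC_CM is proved only modulo the 7 printed citations (2 remaining named inputs: hLiu418 = `stmt-HodgeConjecture-24832`, h413 = `stmt-HodgeConjecture-24833`) until rung 0
closes; this file asserts no named fact and closes no socket; count-neutral.

## References
* [Bump1997] D. Bump, *Automorphic Forms and Representations* (1997), proof of Lemma 2.3.2.
* [BernsteinLapid2019] J. Bernstein, E. Lapid, *On the meromorphic continuation of Eisenstein series* (2019), §4 Claims 1–2.
* [Langlands1976] R. P. Langlands, *On the Functional Equations Satisfied by Eisenstein Series*, LNM 544 (1976), §6.
* [Rogawski1990] J. D. Rogawski, *Automorphic Representations of Unitary Groups in Three Variables* (1990), §12.3 (K-types of `U(2,1)(ℝ)`).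
-/

set_option autoImplicit false
set_option linter.dupNamespace false  -- the mandated namespace repeats the summit's segment

noncomputable section

open MeasureTheory Measure NumberField NumberField.mixedEmbedding IsDedekindDomain Set Filter Topology
open scoped NNReal MatrixGroups Classical Pointwise
open Literature.NumberTheory Literature.NumberTheory.Automorphic Literature.NumberTheory.Automorphic.UnitaryGroup AdelicGroupData
open Literature.NumberTheory.GaloisRepresentations (HeckeCharacter)
open Summit.HodgeConjecture.HodgeConjecture.Cruxes.H413.K2E1BorelEisensteinU
open Summit.HodgeConjecture.HodgeConjecture.Cruxes.H413.K2E1CharacterEisensteinU2Defs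
open Summit.HodgeConjecture.HodgeConjecture.Cruxes.H413.K2E1ChiSectionSpaceU2Defs
open Summit.HodgeConjecture.HodgeConjecture.Cruxes.H413.K2E1ArchPureTensorSelfConvolutionU2
open Summit.HodgeConjecture.HodgeConjecture.Cruxes.H413.K2E1ArchSymbolFormulaU2
open Summit.HodgeConjecture.HodgeConjecture.Cruxes.H413.K2E1ArchTestFunctionSymbolU2 (exists_entire_symbol_of_arch)
open Summit.HodgeConjecture.HodgeConjecture.Cruxes.H413.K2E1SymbolPositivitySecondDifference (integral_ne_zero_of_re_ge_half exists_apply_ne_apply_of_secondDiff)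
open Summit.HodgeConjecture.HodgeConjecture.Cruxes.H413.K2E1TruncatedCuspDecayHNU2 (orbitalSmoothing_self_eq_zero)
open Summit.HodgeConjecture.HodgeConjecture.Cruxes.H413.K2E1BLSelfConvolutionU2 (continuous_selfConv hasCompactSupport_selfConv)
open Summit.HodgeConjecture.HodgeConjecture.Cruxes.H413.K2E1BLUniquenessU3 (one_mem_closure_setOf_one_lt_borelHeight_three)
open Summit.HodgeConjecture.HodgeConjecture.Cruxes.H413.K2E1ArchSymbolCirclePhaseU2 (exists_rOut_forall_support_subset mem_tsupport_mul_of_integral_ne_zero)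
open Summit.HodgeConjecture.HodgeConjecture.Cruxes.H413.K2E1SphericalHeckeEigenSectionU2 (continuous_borelHeight_coe borelHeight_eq_one_of_mem)
namespace Summit.HodgeConjecture.HodgeConjecture.Cruxes.H413.K2E1ArchSymbolCirclePhaseU3

/-! ## §1 `N = 3`: points `a` of `G_∞` arbitrarily close to `1` with `H(ι a) ≠ 1` -/

section Ray

variable {F E : Type} [Field F] [NumberField F] [Field E] [NumberField E] [Algebra F E] {c : E ≃ₐ[F] E}

/-- **`1 ∈ closure {a ∈ G_∞ | H(ι a) ≠ 1}` AT `N = 3`**: every neighbourhood `O` of `1` in `G_∞` contains `a` with `H(ι a) ≠ 1`.  From ★ `one_mem_closure_setOf_one_lt_borelHeight_three` (no `c² = 1` needed at `N = 3`) applied to the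
open neighbourhood `{g | g_∞ ∈ O, g_f ∈ GL₃(𝒪̂_E)}` of `1` in `G(𝔸)`: such `g = ι(g_∞)·ι_f(g_f)` has `ι_f(g_f) ∈ K`, so `H(ι g_∞) = H(g) > 1`. [cite: BernsteinLapid2019, §4 Claim 2] -/
theorem exists_mem_borelHeight_archToAdelic_ne_one_three {O : Set (arch F E c 3 ((StdForm.antidiagonal 3).over E))}
    (hO : O ∈ 𝓝 (1 : arch F E c 3 ((StdForm.antidiagonal 3).over E))) :
    ∃ a ∈ O, borelHeight (archToAdelic F E c 3 ((StdForm.antidiagonal 3).over E) a) ≠ 1 := by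
  -- the open neighbourhood `M = {g | g_∞ ∈ O, (val g)_f ∈ GL₃(𝒪̂_E)}` of `1` in `G(𝔸)`
  have hemb : IsClosedEmbedding (adelicVal F E c 3 ((StdForm.antidiagonal 3).over E)) := (isClosed_adelic F E c 3 ((StdForm.antidiagonal 3).over E)).isClosedEmbedding_subtypeVal
  have hsndc : Continuous fun x : (quasiSplit F E c 3).Adelic => GLn.sndHom 3 E (adelicVal F E c 3 ((StdForm.antidiagonal 3).over E) x) :=
    (GLn.continuous_sndHom (n := 3) (K := E)).comp hemb.continuous
  set M : Set (quasiSplit F E c 3).Adelic := (archPart F E c 3 ((StdForm.antidiagonal 3).over E)) ⁻¹' O ∩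
    {g | GLn.sndHom 3 E (adelicVal F E c 3 ((StdForm.antidiagonal 3).over E) g) ∈ glFiniteIntegralLevel 3 E} with hM
  have hM1 : M ∈ 𝓝 (1 : (quasiSplit F E c 3).Adelic) := by
    refine Filter.inter_mem ((continuous_archPart F E c 3 _).continuousAt.preimage_mem_nhds (by rw [map_one]; exact hO)) ?_
    exact ((isOpen_glFiniteIntegralLevel 3 E).preimage hsndc).mem_nhds (by
      show GLn.sndHom 3 E (adelicVal F E c 3 ((StdForm.antidiagonal 3).over E) 1) ∈ glFiniteIntegralLevel 3 E
      rw [map_one, map_one]; exact (glFiniteIntegralLevel 3 E).one_mem)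
  obtain ⟨g, hgM, hgH⟩ := mem_closure_iff_nhds.1 (one_mem_closure_setOf_one_lt_borelHeight_three (F := F) (E := E) (c := c)) M hM1
  refine ⟨archPart F E c 3 _ g, hgM.1, ?_⟩
  -- `g = ι(g_∞)·ι_f(g_f)` with `ι_f(g_f) ∈ K`, so `H(ι g_∞) = H(g) > 1`
  have hk : finAdelicToAdelic F E c 3 ((StdForm.antidiagonal 3).over E) (finPart F E c 3 _ g) ∈
      (((standardMaximalCompactGL 3 E).comap (adelicVal F E c 3 ((StdForm.antidiagonal 3).over E)) : Subgroup (quasiSplit F E c 3).Adelic)) := by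
    refine Subgroup.mem_comap.2 ((mem_standardMaximalCompactGL_iff_toMixed_sndHom _).2 ⟨?_, ?_⟩)
    · rw [← coe_archPart, archPart_finAdelicToAdelic]
      exact (Kinf 3 E).one_mem
    · rw [← coe_finPart, finPart_finAdelicToAdelic]
      exact hgM.2
  have e : borelHeight (archToAdelic F E c 3 ((StdForm.antidiagonal 3).over E) (archPart F E c 3 _ g)) = borelHeight g := by
    conv_rhs => rw [← archToAdelic_mul_finAdelicToAdelic F E c 3 ((StdForm.antidiagonal 3).over E) g]
    rw [borelHeight_mul_of_mem_comap_standardMaximalCompactGL hk]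
  rw [e]
  exact ne_of_gt hgH

end Ray

/-! ## §2 CORE (`N = 3`): a gauge test function whose symbol on `V(χ, K′, ω)` is entire, `≠ 0` at `z₀`, and non-constant -/

section Core

variable {F E : Type} [Field F] [NumberField F] [Field E] [NumberField E] [Algebra F E] [Algebra.IsQuadraticExtension F E] {c : E ≃ₐ[F] E}
variable [MeasurableSpace (quasiSplit F E c 3).Adelic] [BorelSpace (quasiSplit F E c 3).Adelic]
variable [MeasurableSpace (arch F E c 3 ((StdForm.antidiagonal 3).over E))] [BorelSpace (arch F E c 3 ((StdForm.antidiagonal 3).over E))]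
variable [MeasurableSpace (finAdelic F E c 3 ((StdForm.antidiagonal 3).over E))] [BorelSpace (finAdelic F E c 3 ((StdForm.antidiagonal 3).over E))]
variable (νG : Measure (quasiSplit F E c 3).Adelic) [νG.IsHaarMeasure]
variable (μa : Measure (arch F E c 3 ((StdForm.antidiagonal 3).over E))) [μa.IsHaarMeasure] [μa.IsMulRightInvariant]
variable (μf : Measure (finAdelic F E c 3 ((StdForm.antidiagonal 3).over E))) [μf.IsHaarMeasure]
variable {χ : HeckeCharacter E} {K' : Subgroup (quasiSplit F E c 3).Adelic} {ω : ↥K' → ℂ}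

set_option maxHeartbeats 400000 in
include μa μf in
/-- **CORE**: for `c ≠ 1` fixing the infinite places (no `c² = 1` at `N = 3`), `K′ ≤ K` containing `ι(K_∞)`, an open compact `U₀ ≤ GL₃(𝔸_E^∞)` with `ι_f(U₀ ∩ G_f) ⊆ K′` acting trivially, continuous sections, and
any `z₀`: some gauge test function `η_ψ = α_ψ ⊗ 𝟙_{U₀}` has an ENTIRE symbol `s` on `V(χ, K′, ω)` (`∫ S_{η̃}η̃·f_z^φ(x·) = s(z)f_z^φ(x)`) with `s(z₀) ≠ 0` and `s` NON-CONSTANT.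
[cite: Bump1997, proof of Lemma 2.3.2] [cite: BernsteinLapid2019, §4 Claim 1] [cite: Langlands1976, §6] -/
theorem exists_gauge_symbol_three (hc : c ≠ 1) (hfix : ∀ w : InfinitePlace E, c • w = w)
    (hK' : K' ≤ ((standardMaximalCompactGL 3 E).comap (adelicVal F E c 3 ((StdForm.antidiagonal 3).over E)) : Subgroup (quasiSplit F E c 3).Adelic))
    (hKinf : ∀ k : arch F E c 3 ((StdForm.antidiagonal 3).over E), adelicVal F E c 3 ((StdForm.antidiagonal 3).over E) (archToAdelic F E c 3 _ k) ∈ standardMaximalCompactGL 3 E → archToAdelic F E c 3 _ k ∈ K')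
    (U₀ : Subgroup (GL (Fin 3) (FiniteAdeleRing (𝓞 E) E))) (hU₀o : IsOpen (U₀ : Set (GL (Fin 3) (FiniteAdeleRing (𝓞 E) E)))) (hU₀c : IsCompact (U₀ : Set (GL (Fin 3) (FiniteAdeleRing (𝓞 E) E))))
    (hU : ∀ b : finAdelic F E c 3 ((StdForm.antidiagonal 3).over E), (b : GL (Fin 3) (FiniteAdeleRing (𝓞 E) E)) ∈ U₀ → ∃ hb : finAdelicToAdelic F E c 3 ((StdForm.antidiagonal 3).over E) b ∈ K', ω ⟨_, hb⟩ = 1)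
    (hVc : ∀ φ ∈ chiSectionSpace χ K' ω, Continuous φ) (z₀ : ℂ) :
    ∃ ψ : ContDiffBump (0 : ℝ), ∃ s : ℂ → ℂ, Differentiable ℂ s ∧ s z₀ ≠ 0 ∧ (∃ z₁ z₂ : ℂ, s z₁ ≠ s z₂) ∧
      ∀ z : ℂ, ∀ φ ∈ chiSectionSpace χ K' ω, ∀ x : (quasiSplit F E c 3).Adelic,
        (∫ y, (fun y : (quasiSplit F E c 3).Adelic => orbitalSmoothing νG
            (fun x : (quasiSplit F E c 3).Adelic => (((adelicWeight U₀ (archBump ψ) (adelicVal F E c 3 ((StdForm.antidiagonal 3).over E) x)) : ℝ) : ℂ))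
            (fun x : (quasiSplit F E c 3).Adelic => (((adelicWeight U₀ (archBump ψ) (adelicVal F E c 3 ((StdForm.antidiagonal 3).over E) x)) : ℝ) : ℂ)) y) y *
          flatSectionU φ z (x * y) ∂νG) = s z * flatSectionU φ z x := by
  by_cases hV : ∃ φ₀ ∈ chiSectionSpace χ K' ω, ∃ x₁ : (quasiSplit F E c 3).Adelic, φ₀ x₁ ≠ 0
  swap
  · -- degenerate case: every section vanishes identically
    push Not at hV
    refine ⟨⟨1, 2, one_pos, one_lt_two⟩, fun z => z - z₀ + 1, (differentiable_id.sub_const z₀).add_const 1, by simp only [sub_self, zero_add, ne_eq, one_ne_zero, not_false_eq_true],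
      ⟨1, 0, fun h => one_ne_zero (by linear_combination h)⟩, fun z φ hφ x => ?_⟩
    have hφ0 : φ = 0 := funext fun y => hV φ hφ y
    subst hφ0
    have h0 : ∀ y, flatSectionU (0 : (quasiSplit F E c 3).Adelic → ℂ) z y = 0 := fun y => by rw [flatSectionU_apply, Pi.zero_apply, zero_mul]
    simp only [h0, mul_zero, integral_zero]
  obtain ⟨φ₀, hφ₀, x₁, hx₁⟩ := hV
  -- a point of `K` where `φ₀` does not vanish
  obtain ⟨b, hb, k₀, hk₀K, rfl⟩ := exists_mem_borelAdelic_mul_mem_standardMaximalCompactGL c hc hfix x₁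
  have hk₀ : φ₀ k₀ ≠ 0 := by
    intro h0; apply hx₁
    rw [((mem_chiSectionSpace_iff _).1 hφ₀).1 b hb k₀, h0, mul_zero]
  have hk₀K' : k₀ ∈ (((standardMaximalCompactGL 3 E).comap (adelicVal F E c 3 ((StdForm.antidiagonal 3).over E))) : Subgroup (quasiSplit F E c 3).Adelic) := Subgroup.mem_comap.2 hk₀K
  have hHk₀ : ((borelHeight k₀ : ℝ≥0) : ℝ) = 1 := by rw [borelHeight_eq_one_of_mem hk₀K, NNReal.coe_one]
  -- the phase-control neighbourhood and the bump radius
  have hW := setOf_half_le_re_mem_nhds_one (hVc φ₀ hφ₀) hk₀ z₀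
  obtain ⟨r, hr, hrW⟩ := exists_rOut_forall_support_subset μa hW
  let ψ : ContDiffBump (0 : ℝ) := ⟨r / 2, r, half_pos hr, half_lt_self hr⟩
  have hψr : ψ.rOut = r := rfl
  -- the test function, its pull-back and its self-convolution
  have hηT : IsTestFunctionGL 3 E (adelicWeight U₀ (archBump ψ)) := isTestFunctionGL_gaugeWeight ψ U₀ hU₀o hU₀c
  have hemb : IsClosedEmbedding (adelicVal F E c 3 ((StdForm.antidiagonal 3).over E)) := (isClosed_adelic F E c 3 ((StdForm.antidiagonal 3).over E)).isClosedEmbedding_subtypeVal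
  set ηt : (quasiSplit F E c 3).Adelic → ℂ := fun x => (((adelicWeight U₀ (archBump ψ) (adelicVal F E c 3 ((StdForm.antidiagonal 3).over E) x)) : ℝ) : ℂ) with hηt
  have hηc : Continuous ηt := Complex.continuous_ofReal.comp (hηT.continuous.comp hemb.continuous)
  have hηs : HasCompactSupport ηt := (hηT.hasCompactSupport.comp_isClosedEmbedding hemb).comp_left Complex.ofReal_zero
  set h : (quasiSplit F E c 3).Adelic → ℂ := fun y => orbitalSmoothing νG ηt ηt y with hh
  have hhc : Continuous h := continuous_selfConv νG hηc hηs
  have hhs : HasCompactSupport h := hasCompactSupport_selfConv νG hηs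
  -- the pure-tensor shape (★ 2b) and 12d-C's binders
  obtain ⟨κ₁, hκ₁, hten⟩ := selfConv_gaugeWeight_eq_pureTensor νG μa μf ψ U₀ hU₀o
  set U : Set (finAdelic F E c 3 ((StdForm.antidiagonal 3).over E)) := ↑(U₀.subgroupOf (finAdelic F E c 3 ((StdForm.antidiagonal 3).over E))) with hUdef
  set αψ : arch F E c 3 ((StdForm.antidiagonal 3).over E) → ℂ := fun x => ((archBump ψ ((x : arch F E c 3 ((StdForm.antidiagonal 3).over E)) : GL (Fin 3) (mixedSpace E)) : ℝ) : ℂ) with hαψ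
  set hinf : arch F E c 3 ((StdForm.antidiagonal 3).over E) → ℂ := fun a => ((κ₁ : ℝ) : ℂ) * (μf.real U : ℂ) * ∫ x, αψ x * αψ (x⁻¹ * a) ∂μa with hhinf
  have hten' : ∀ y, h y = hinf (archPart F E c 3 _ y) * U.indicator (fun _ => (1 : ℂ)) (finPart F E c 3 _ y) := hten
  have hUm : MeasurableSet U := (hU₀o.preimage continuous_subtype_val).measurableSet
  have hU' : ∀ b ∈ U, ∃ hb : finAdelicToAdelic F E c 3 ((StdForm.antidiagonal 3).over E) b ∈ K', ω ⟨_, hb⟩ = 1 := fun b hb => hU b (Subgroup.mem_subgroupOf.1 hb)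
  have hcent : ∀ k ∈ (((standardMaximalCompactGL 3 E).comap (adelicVal F E c 3 ((StdForm.antidiagonal 3).over E))).comap (archToAdelic F E c 3 ((StdForm.antidiagonal 3).over E))), ∀ y, hinf (k⁻¹ * y * k) = hinf y :=
    fun k hk y => archSelfConv_conj μa ψ (((κ₁ : ℝ) : ℂ) * (μf.real U : ℂ)) hk y
  -- ★ P1: one entire symbol with the action clause; ★ 2c-A: its integral formula at `(φ₀, k₀)`
  obtain ⟨s, hsd, hact⟩ := exists_entire_symbol_of_arch νG μa μf hc hfix hK' hKinf hhc hhs hten' hcent hU' hVc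
  obtain ⟨κ₂, hκ₂, hform⟩ := symbol_eq_integral_arch νG μa μf hK' hUm hten' hU' hact hφ₀ hk₀
  -- the phase `Φ`, the ratio `R > 0`, and the REAL weight `w ≥ 0` with `s z = ∫ w·Φ·R^z`
  set Φ : arch F E c 3 ((StdForm.antidiagonal 3).over E) → ℂ := fun a => φ₀ (k₀ * archToAdelic F E c 3 _ a) / φ₀ k₀ with hΦ
  set R : arch F E c 3 ((StdForm.antidiagonal 3).over E) → ℝ := fun a => ((borelHeight (k₀ * archToAdelic F E c 3 _ a) : ℝ≥0) : ℝ) / ((borelHeight k₀ : ℝ≥0) : ℝ) with hR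
  have hRpos : ∀ a, 0 < R a := fun a => ratio_pos k₀ a
  have hΦc : Continuous Φ := continuous_phase (hVc φ₀ hφ₀) k₀
  have hRc : Continuous R := continuous_ratio (F := F) (E := E) (c := c) (N := 3) k₀
  have hRzc : ∀ z : ℂ, Continuous fun a => (((R a : ℝ)) : ℂ) ^ z := fun z =>
    Continuous.cpow (Complex.continuous_ofReal.comp hRc) continuous_const fun a => Or.inl (by exact_mod_cast hRpos a)
  set w : arch F E c 3 ((StdForm.antidiagonal 3).over E) → ℝ := fun a => ((κ₂ : ℝ) * μf.real U) * (((κ₁ : ℝ) * μf.real U) *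
    ∫ x, archBump ψ ((x : arch F E c 3 ((StdForm.antidiagonal 3).over E)) : GL (Fin 3) (mixedSpace E)) * archBump ψ ((x⁻¹ * a : arch F E c 3 ((StdForm.antidiagonal 3).over E)) : GL (Fin 3) (mixedSpace E)) ∂μa) with hw
  have hhinf_eq : ∀ a, hinf a = ((((κ₁ : ℝ) * μf.real U) * ∫ x, archBump ψ ((x : arch F E c 3 ((StdForm.antidiagonal 3).over E)) : GL (Fin 3) (mixedSpace E)) *
      archBump ψ ((x⁻¹ * a : arch F E c 3 ((StdForm.antidiagonal 3).over E)) : GL (Fin 3) (mixedSpace E)) ∂μa : ℝ) : ℂ) := fun a => by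
    simp only [hhinf, hαψ, integral_archBump_mul_eq_ofReal μa ψ a]; push_cast; ring
  have hw_eq : ∀ a, ((w a : ℝ) : ℂ) = ((κ₂ : ℝ) : ℂ) * (μf.real U : ℂ) * hinf a := fun a => by
    rw [hhinf_eq]; simp only [hw]; push_cast; ring
  have hs_formula : ∀ z : ℂ, s z = ∫ a, ((w a : ℝ) : ℂ) * (Φ a * (((R a : ℝ)) : ℂ) ^ z) ∂μa := fun z => by
    rw [hform z, ← integral_const_mul]
    refine integral_congr_ae (Eventually.of_forall fun a => ?_)
    simp only [hw_eq, hΦ, hR, mul_assoc]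
  -- properties of `w`: `≥ 0`, `= κ₂μ_f(U)·Re h(ι ·)` hence continuous, compactly supported, positive integral
  have hw0 : ∀ a, 0 ≤ w a := fun a =>
    mul_nonneg (mul_nonneg κ₂.2 measureReal_nonneg) (mul_nonneg (mul_nonneg κ₁.2 measureReal_nonneg) (integral_archBump_mul_nonneg μa ψ a))
  have h1U : (1 : finAdelic F E c 3 ((StdForm.antidiagonal 3).over E)) ∈ U := (U₀.subgroupOf (finAdelic F E c 3 ((StdForm.antidiagonal 3).over E))).one_mem
  have hhinf_cont : Continuous hinf := by
    have e : hinf = fun a => h (archToAdelic F E c 3 _ a) := by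
      funext a
      rw [hten', archPart_archToAdelic, finPart_archToAdelic, Set.indicator_of_mem h1U, mul_one]
    rw [e]; exact hhc.comp (continuous_archToAdelic F E c 3 _)
  have hwc : Continuous w := by
    have e : w = fun a => (((κ₂ : ℝ) : ℂ) * (μf.real U : ℂ) * hinf a).re := by
      funext a; rw [← hw_eq, Complex.ofReal_re]
    rw [e]; exact Complex.continuous_re.comp (continuous_const.mul hhinf_cont)
  have hαs : HasCompactSupport αψ := by
    have e : αψ = Complex.ofReal ∘ fun x : arch F E c 3 ((StdForm.antidiagonal 3).over E) => archBump ψ ((x : arch F E c 3 ((StdForm.antidiagonal 3).over E)) : GL (Fin 3) (mixedSpace E)) := rfl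
    rw [e]
    exact HasCompactSupport.comp_left (hasCompactSupport_archBump_coe (F := F) (c := c) (N := 3) ψ) Complex.ofReal_zero
  have hw_supp : ∀ a, w a ≠ 0 → (∫ x, αψ x * αψ (x⁻¹ * a) ∂μa) ≠ 0 := by
    intro a ha h0
    apply ha
    have e := hw_eq a
    simp only [hhinf, h0, mul_zero] at e
    exact_mod_cast e
  have hws : HasCompactSupport w :=
    HasCompactSupport.of_support_subset_isCompact (hαs.isCompact.mul hαs.isCompact) fun a ha => mem_tsupport_mul_of_integral_ne_zero μa ψ (hw_supp a ha)
  have hwi : Integrable w μa := hwc.integrable_of_hasCompactSupport hws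
  have hwsC : HasCompactSupport fun a => ((w a : ℝ) : ℂ) := by
    have e : (fun a => ((w a : ℝ) : ℂ)) = Complex.ofReal ∘ w := rfl
    rw [e]; exact HasCompactSupport.comp_left hws Complex.ofReal_zero
  have hIc : ∀ G : arch F E c 3 ((StdForm.antidiagonal 3).over E) → ℂ, Continuous G → Integrable (fun a => ((w a : ℝ) : ℂ) * G a) μa := fun G hG =>
    ((Complex.continuous_ofReal.comp hwc).mul hG).integrable_of_hasCompactSupport hwsC.mul_right
  have hIr : ∀ G : arch F E c 3 ((StdForm.antidiagonal 3).over E) → ℝ, Continuous G → Integrable (fun a => w a * G a) μa := fun G hG =>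
    (hwc.mul hG).integrable_of_hasCompactSupport (hws.mul_right)
  have hUpos : 0 < μf.real U := by
    have hUo : IsOpen U := hU₀o.preimage continuous_subtype_val
    have hUc : IsCompact U := (isClosed_finAdelic F E c 3 ((StdForm.antidiagonal 3).over E)).isClosedEmbedding_subtypeVal.isCompact_preimage hU₀c
    exact ENNReal.toReal_pos (hUo.measure_ne_zero μf ⟨1, h1U⟩) hUc.measure_lt_top.ne
  have hw1 : w 1 ≠ 0 := ne_of_gt (mul_pos (mul_pos hκ₂ hUpos) (mul_pos (mul_pos hκ₁ hUpos) (integral_archBump_mul_one_pos μa ψ)))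
  have hpos : 0 < ∫ a, w a ∂μa := hwc.integral_pos_of_hasCompactSupport_nonneg_nonzero hws hw0 hw1
  -- phase control on the support of `w`
  have hWmem : ∀ a, w a ≠ 0 → (1 / 2 : ℝ) ≤ (Φ a * (((R a : ℝ)) : ℂ) ^ z₀).re ∧ (1 / 2 : ℝ) ≤ (Φ a).re := fun a ha =>
    hrW ψ (le_of_eq hψr) a (hw_supp a ha)
  -- (1) `s(z₀) ≠ 0`
  have hs0 : s z₀ ≠ 0 := by
    rw [hs_formula z₀]
    exact integral_ne_zero_of_re_ge_half μa hw0 (fun a ha => (hWmem a ha).1) hwi (hIc _ (hΦc.mul (hRzc z₀))) hpos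
  -- (2) non-constancy: the set `{w ≠ 0, R ≠ 1}` has positive measure (the arch ray through `k_{0,∞}`)
  have hch : μa {a | w a ≠ 0 ∧ R a ≠ 1} ≠ 0 := by
    set kinf : arch F E c 3 ((StdForm.antidiagonal 3).over E) := archPart F E c 3 _ k₀ with hkinf
    have hO : {a' : arch F E c 3 ((StdForm.antidiagonal 3).over E) | w (kinf⁻¹ * a' * kinf) ≠ 0} ∈ 𝓝 (1 : arch F E c 3 ((StdForm.antidiagonal 3).over E)) :=
      (isOpen_ne_fun (hwc.comp ((continuous_const.mul continuous_id).mul continuous_const)) continuous_const).mem_nhds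
        (by show w (kinf⁻¹ * 1 * kinf) ≠ 0; rwa [mul_one, inv_mul_cancel])
    obtain ⟨a', ha', hH'⟩ := exists_mem_borelHeight_archToAdelic_ne_one_three hO
    have hR' : R (kinf⁻¹ * a' * kinf) ≠ 1 := by
      have hd : k₀ = archToAdelic F E c 3 _ kinf * finAdelicToAdelic F E c 3 _ (finPart F E c 3 _ k₀) :=
        (archToAdelic_mul_finAdelicToAdelic F E c 3 ((StdForm.antidiagonal 3).over E) k₀).symm
      have hc' : finAdelicToAdelic F E c 3 _ (finPart F E c 3 _ k₀) * archToAdelic F E c 3 _ (kinf⁻¹ * a' * kinf) =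
          archToAdelic F E c 3 _ (kinf⁻¹ * a' * kinf) * finAdelicToAdelic F E c 3 _ (finPart F E c 3 _ k₀) :=
        (commute_archToAdelic_finAdelicToAdelic F E c 3 _ (kinf⁻¹ * a' * kinf) (finPart F E c 3 _ k₀)).eq.symm
      have ek : k₀ * archToAdelic F E c 3 _ (kinf⁻¹ * a' * kinf) = archToAdelic F E c 3 _ a' * k₀ := by
        calc k₀ * archToAdelic F E c 3 _ (kinf⁻¹ * a' * kinf)
            = archToAdelic F E c 3 _ kinf * (finAdelicToAdelic F E c 3 _ (finPart F E c 3 _ k₀) * archToAdelic F E c 3 _ (kinf⁻¹ * a' * kinf)) := by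
              conv_lhs => rw [hd]
              rw [mul_assoc]
          _ = archToAdelic F E c 3 _ (kinf * (kinf⁻¹ * a' * kinf)) * finAdelicToAdelic F E c 3 _ (finPart F E c 3 _ k₀) := by rw [hc', ← mul_assoc, ← map_mul]
          _ = archToAdelic F E c 3 _ (a' * kinf) * finAdelicToAdelic F E c 3 _ (finPart F E c 3 _ k₀) := by
              rw [show kinf * (kinf⁻¹ * a' * kinf) = a' * kinf by group]
          _ = archToAdelic F E c 3 _ a' * k₀ := by rw [map_mul, mul_assoc, ← hd]
      show ((borelHeight (k₀ * archToAdelic F E c 3 _ (kinf⁻¹ * a' * kinf)) : ℝ≥0) : ℝ) / ((borelHeight k₀ : ℝ≥0) : ℝ) ≠ 1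
      rw [ek, borelHeight_mul_of_mem_comap_standardMaximalCompactGL hk₀K', hHk₀, div_one, Ne, NNReal.coe_eq_one]
      exact hH'
    have hmem : kinf⁻¹ * a' * kinf ∈ ({a | w a ≠ 0} ∩ {a | R a ≠ 1} : Set (arch F E c 3 ((StdForm.antidiagonal 3).over E))) := ⟨ha', hR'⟩
    rw [Set.setOf_and]
    exact ((isOpen_ne_fun hwc continuous_const).inter (isOpen_ne_fun hRc continuous_const)).measure_ne_zero μa ⟨_, hmem⟩
  have hnc : ∃ z₁ z₂ : ℂ, s z₁ ≠ s z₂ := by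
    refine exists_apply_ne_apply_of_secondDiff μa hw0 hRpos (fun a ha => (hWmem a ha).2) 0 (s := s) (fun z _ => ?_) (hIc _ (hΦc.mul (hRzc _)))
      (hIc _ (hΦc.mul (hRzc _))) (hIc _ (hΦc.mul (hRzc _))) (hIr _ ?_) (hIc _ (hΦc.mul ((hRzc _).mul ((Complex.continuous_ofReal.comp hRc).sub continuous_const |>.pow 2)))) hch
    · exact hs_formula z
    · exact (hRc.rpow_const fun a => Or.inl (hRpos a).ne').mul ((hRc.sub continuous_const).pow 2)
  refine ⟨ψ, s, hsd, hs0, hnc, fun z φ hφ x => ?_⟩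
  have e := hact z φ hφ x
  simp only [hh, hηt] at e
  exact e

end Core

/-! ## §3 HEADS (CM, `N = 3`): convData_χ's `hfam`∕`hnc` at `V := chiSectionSpace χ K′ ω`, every `(χ_∞, ω)` -/

section Heads

variable (L : Type) [Field L] [NumberField L] [IsCMField L]
variable [MeasurableSpace (quasiSplit (↥(maximalRealSubfield L)) L (IsCMField.complexConj L) 3).Adelic] [BorelSpace (quasiSplit (↥(maximalRealSubfield L)) L (IsCMField.complexConj L) 3).Adelic]
variable [MeasurableSpace (arch (↥(maximalRealSubfield L)) L (IsCMField.complexConj L) 3 ((StdForm.antidiagonal 3).over L))] [BorelSpace (arch (↥(maximalRealSubfield L)) L (IsCMField.complexConj L) 3 ((StdForm.antidiagonal 3).over L))]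
variable [MeasurableSpace (finAdelic (↥(maximalRealSubfield L)) L (IsCMField.complexConj L) 3 ((StdForm.antidiagonal 3).over L))] [BorelSpace (finAdelic (↥(maximalRealSubfield L)) L (IsCMField.complexConj L) 3 ((StdForm.antidiagonal 3).over L))]
variable (νG : Measure (quasiSplit (↥(maximalRealSubfield L)) L (IsCMField.complexConj L) 3).Adelic) [νG.IsHaarMeasure]
variable (μa : Measure (arch (↥(maximalRealSubfield L)) L (IsCMField.complexConj L) 3 ((StdForm.antidiagonal 3).over L))) [μa.IsHaarMeasure] [μa.IsMulRightInvariant]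
variable (μf : Measure (finAdelic (↥(maximalRealSubfield L)) L (IsCMField.complexConj L) 3 ((StdForm.antidiagonal 3).over L))) [μf.IsHaarMeasure]
variable {χ : HeckeCharacter L} {K' : Subgroup (quasiSplit (↥(maximalRealSubfield L)) L (IsCMField.complexConj L) 3).Adelic} {ω : ↥K' → ℂ}

include μa μf in
/-- **HEAD `hfam` FOR EVERY `(χ_∞, ω)`** — the letter `hfam` of ★ `K2E1ChiConvDataCMThree.exists_chi_convData_cm_three` at `V := chiSectionSpace χ K′ ω`: for every `z₀` a symmetric non-negative
`GL₃(𝔸_L)` test function `η = α_ψ ⊗ 𝟙_{U₀}` (archimedean gauge bump × an open compact level inside `K′` on which `ω = 1`) and an ENTIRE `s` with `s z₀ ≠ 0` such that `S_η̃ η̃` acts on every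
`f_z^φ`, `φ ∈ V`, by `s(z)`.  Binders: `K′ ≤ K`, `ι(K_∞) ⊆ K′`, `U₀` open compact with `ι_f(U₀ ∩ G_f) ⊆ K′` and `ω = 1` there, continuous sections, a two-sided Haar measure `μ_∞` on `G_∞`
(and any Haar `μ_f` on `G(𝔸_f)`; both only enter the proof). [cite: Bump1997, proof of Lemma 2.3.2] [cite: BernsteinLapid2019, §4 Claim 1] -/
theorem hfam_gauge_cm_three
    (hK' : K' ≤ ((standardMaximalCompactGL 3 L).comap (adelicVal (↥(maximalRealSubfield L)) L (IsCMField.complexConj L) 3 ((StdForm.antidiagonal 3).over L)) : Subgroup (quasiSplit (↥(maximalRealSubfield L)) L (IsCMField.complexConj L) 3).Adelic))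
    (hKinf : ∀ k : arch (↥(maximalRealSubfield L)) L (IsCMField.complexConj L) 3 ((StdForm.antidiagonal 3).over L), adelicVal (↥(maximalRealSubfield L)) L (IsCMField.complexConj L) 3 ((StdForm.antidiagonal 3).over L) (archToAdelic (↥(maximalRealSubfield L)) L (IsCMField.complexConj L) 3 _ k) ∈ standardMaximalCompactGL 3 L →
      archToAdelic (↥(maximalRealSubfield L)) L (IsCMField.complexConj L) 3 _ k ∈ K')
    (U₀ : Subgroup (GL (Fin 3) (FiniteAdeleRing (𝓞 L) L))) (hU₀o : IsOpen (U₀ : Set (GL (Fin 3) (FiniteAdeleRing (𝓞 L) L)))) (hU₀c : IsCompact (U₀ : Set (GL (Fin 3) (FiniteAdeleRing (𝓞 L) L))))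
    (hU : ∀ b : finAdelic (↥(maximalRealSubfield L)) L (IsCMField.complexConj L) 3 ((StdForm.antidiagonal 3).over L), (b : GL (Fin 3) (FiniteAdeleRing (𝓞 L) L)) ∈ U₀ →
      ∃ hb : finAdelicToAdelic (↥(maximalRealSubfield L)) L (IsCMField.complexConj L) 3 ((StdForm.antidiagonal 3).over L) b ∈ K', ω ⟨_, hb⟩ = 1)
    (hVc : ∀ φ ∈ chiSectionSpace χ K' ω, Continuous φ) :
    ∀ z₀ : ℂ, ∃ η : GL (Fin 3) (AdeleRing (𝓞 L) L) → ℝ, IsTestFunctionGL 3 L η ∧ (∀ g, 0 ≤ η g) ∧ (∀ g, η g⁻¹ = η g) ∧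
      ∃ s : ℂ → ℂ, Differentiable ℂ s ∧ s z₀ ≠ 0 ∧ ∀ z : ℂ, ∀ φ ∈ chiSectionSpace χ K' ω, ∀ x : (quasiSplit (↥(maximalRealSubfield L)) L (IsCMField.complexConj L) 3).Adelic,
        (∫ y, (fun y : (quasiSplit (↥(maximalRealSubfield L)) L (IsCMField.complexConj L) 3).Adelic => orbitalSmoothing νG (fun x : (quasiSplit (↥(maximalRealSubfield L)) L (IsCMField.complexConj L) 3).Adelic => ((η (adelicVal (↥(maximalRealSubfield L)) L (IsCMField.complexConj L) 3 ((StdForm.antidiagonal 3).over L) x) : ℝ) : ℂ)) (fun x : (quasiSplit (↥(maximalRealSubfield L)) L (IsCMField.complexConj L) 3).Adelic => ((η (adelicVal (↥(maximalRealSubfield L)) L (IsCMField.complexConj L) 3 ((StdForm.antidiagonal 3).over L) x) : ℝ) : ℂ)) y) y *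
          flatSectionU φ z (x * y) ∂νG) = s z * flatSectionU φ z x := by
  intro z₀
  obtain ⟨ψ, s, hsd, hs0, -, hact⟩ := exists_gauge_symbol_three νG μa μf (IsCMField.complexConj_ne_one L) (complexConj_smul_infinitePlace L) hK' hKinf U₀ hU₀o hU₀c hU hVc z₀
  exact ⟨fun g => adelicWeight U₀ (archBump ψ) g, isTestFunctionGL_gaugeWeight ψ U₀ hU₀o hU₀c, gaugeWeight_nonneg ψ U₀, gaugeWeight_inv ψ U₀, s, hsd, hs0, hact⟩

include μa μf in
/-- **HEAD `hnc` FOR EVERY `(χ_∞, ω)`** — the letter `hnc` of ★ `exists_chi_convData_cm_three` at `V := chiSectionSpace χ K′ ω`: ONE such test function whose entire symbol is NON-CONSTANT (second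
difference `∫ w·Φ·R^{z−1}(R−1)² ≠ 0`, K2E1-p11's ★ engine, the arch ray).  Same binders as `hfam_gauge_cm_two`. [cite: Bump1997, proof of Lemma 2.3.2] [cite: Langlands1976, §6] -/
theorem hnc_gauge_cm_three
    (hK' : K' ≤ ((standardMaximalCompactGL 3 L).comap (adelicVal (↥(maximalRealSubfield L)) L (IsCMField.complexConj L) 3 ((StdForm.antidiagonal 3).over L)) : Subgroup (quasiSplit (↥(maximalRealSubfield L)) L (IsCMField.complexConj L) 3).Adelic))
    (hKinf : ∀ k : arch (↥(maximalRealSubfield L)) L (IsCMField.complexConj L) 3 ((StdForm.antidiagonal 3).over L), adelicVal (↥(maximalRealSubfield L)) L (IsCMField.complexConj L) 3 ((StdForm.antidiagonal 3).over L) (archToAdelic (↥(maximalRealSubfield L)) L (IsCMField.complexConj L) 3 _ k) ∈ standardMaximalCompactGL 3 L →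
      archToAdelic (↥(maximalRealSubfield L)) L (IsCMField.complexConj L) 3 _ k ∈ K')
    (U₀ : Subgroup (GL (Fin 3) (FiniteAdeleRing (𝓞 L) L))) (hU₀o : IsOpen (U₀ : Set (GL (Fin 3) (FiniteAdeleRing (𝓞 L) L)))) (hU₀c : IsCompact (U₀ : Set (GL (Fin 3) (FiniteAdeleRing (𝓞 L) L))))
    (hU : ∀ b : finAdelic (↥(maximalRealSubfield L)) L (IsCMField.complexConj L) 3 ((StdForm.antidiagonal 3).over L), (b : GL (Fin 3) (FiniteAdeleRing (𝓞 L) L)) ∈ U₀ →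
      ∃ hb : finAdelicToAdelic (↥(maximalRealSubfield L)) L (IsCMField.complexConj L) 3 ((StdForm.antidiagonal 3).over L) b ∈ K', ω ⟨_, hb⟩ = 1)
    (hVc : ∀ φ ∈ chiSectionSpace χ K' ω, Continuous φ) :
    ∃ η : GL (Fin 3) (AdeleRing (𝓞 L) L) → ℝ, IsTestFunctionGL 3 L η ∧ (∀ g, 0 ≤ η g) ∧ (∀ g, η g⁻¹ = η g) ∧
      ∃ s : ℂ → ℂ, Differentiable ℂ s ∧ (∃ z₁ z₂ : ℂ, s z₁ ≠ s z₂) ∧ ∀ z : ℂ, ∀ φ ∈ chiSectionSpace χ K' ω, ∀ x : (quasiSplit (↥(maximalRealSubfield L)) L (IsCMField.complexConj L) 3).Adelic,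
        (∫ y, (fun y : (quasiSplit (↥(maximalRealSubfield L)) L (IsCMField.complexConj L) 3).Adelic => orbitalSmoothing νG (fun x : (quasiSplit (↥(maximalRealSubfield L)) L (IsCMField.complexConj L) 3).Adelic => ((η (adelicVal (↥(maximalRealSubfield L)) L (IsCMField.complexConj L) 3 ((StdForm.antidiagonal 3).over L) x) : ℝ) : ℂ)) (fun x : (quasiSplit (↥(maximalRealSubfield L)) L (IsCMField.complexConj L) 3).Adelic => ((η (adelicVal (↥(maximalRealSubfield L)) L (IsCMField.complexConj L) 3 ((StdForm.antidiagonal 3).over L) x) : ℝ) : ℂ)) y) y *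
          flatSectionU φ z (x * y) ∂νG) = s z * flatSectionU φ z x := by
  obtain ⟨ψ, s, hsd, -, hnc, hact⟩ := exists_gauge_symbol_three νG μa μf (IsCMField.complexConj_ne_one L) (complexConj_smul_infinitePlace L) hK' hKinf U₀ hU₀o hU₀c hU hVc 0
  exact ⟨fun g => adelicWeight U₀ (archBump ψ) g, isTestFunctionGL_gaugeWeight ψ U₀ hU₀o hU₀c, gaugeWeight_nonneg ψ U₀, gaugeWeight_inv ψ U₀, s, hsd, hnc, hact⟩

end Heads

end Summit.HodgeConjecture.HodgeConjecture.Cruxes.H413.K2E1ArchSymbolCirclePhaseU3
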